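import Summits.QuantumFields.YangMills.Theorems.UnitScaleTiltAvgActionDefectEml
import Summits.QuantumFields.YangMills.Theorems.UnitScaleTiltAvgActionDefectLoops
import Literature.MathematicalPhysics.QuantumFieldTheory.Balaban1983to89.BlockAveragingPlaquetteBound
import HarnessLib

/-!
# Route `UnitScaleTilt`, crux K1 child «MinimiserStabilityRegPr» (stmt-QuantumFields-19200), stub `stub_avgActionDefect` — helper 3:
# THE COARSE PLAQUETTE OF THE (0.4)-AVERAGED FIELD TO FIRST ORDER — `|Ū(∂p′) − 1| ≤ L^{−d} Σ_{x ∈ B(p′₋)} Σ_{q ⊂ sq(x)} |U(∂q) − 1| + 435·t²`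

Cell `ym3-torus` (HUMAN RULING D-0037, YM ladder rung R3), seat `ym3-torus-p1` gen 8 (UV side).  For Bałaban's block averaging
[Balaban1987RG1] (0.4) with the printed inner operation `exp[mean log]` on `SU(N)` (tree `BlockAveraging.blockAvg ExpMeanLog.expMeanLogSU`)
and a configuration `U` with `|U(∂q) − 1| < a` for all fine plaquettes, `t := (((d+2)L)²/4)·a ≤ 1/10`, `t < δ_N`:

* §1 `mean_comp_fst`: averaging a function of `(r, σ, σ′) ∈ Idx P` over the COUPLED index `(r, σ₀, σ₁, σ₂, σ₃)` through each of the four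
  matched projections (a product decomposition of the coupled index) is averaging over `Idx P`; `mean_of_fst` (functions of the offset only).
* §2 `coe_corr_eq_eml`, `coe_corr_inv_eq_eml`: on small fields the correction factor `corr(c)` (and its inverse) IS `eml` of the loop
  family (of the inverse loop family) over `Idx P`; `norm_corr_sub_mean_le` / `norm_corr_inv_sub_mean_le`: each is within `7t²` of
  `1 +` the mean deviation (helper 1 `norm_eml_sub_one_sub_mean_le`).
* §3 **`dist1_plaqHol_avgFun_le_mean_add`**: `|Ū(∂p′) − 1| ≤ L^{−d}·Σ_r Σ_{t,s<L} |U(∂q_{r,s,t}) − 1| + 435·t²`, the `q_{r,s,t}` being the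
  `L²` fine plaquettes of the `L × L` square based at `blockSite p′₋ r` — helper 1 `norm_prod4_sub_mean_le` at `X_i = corr(c_i)^{±1} − 1`,
  `Y_i(k) =` the matched loop variables `− 1`, and helper 2 `dist1_fourLoops_le`.

The zeroth-order sibling (tree `BlockAveragingPlaquetteBound.dist1_plaqHol_avgFun_lt`) gives only `(L² + 6((d+2)L)²)·a`; the first-order
statement is what makes the quadratic part of the averaging action defect EXACT (helper 4).
-/

noncomputable section

open NormedSpace
open scoped BigOperators Matrix.Norms.L2Operator

namespace Summit.QuantumFields.YangMills.Theorems.AvgActionDefect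

open Literature.MathematicalPhysics.QuantumFieldTheory.Balaban1983to89
open T4Continuum BlockAveraging AveragingRT B10Eq47AxialChi ExpMeanLog LatticeWordStokes BlockAveragingPlaquetteBound

/-! ## §1 The coupled index of the four loops and its four uniform projections -/

section Index

variable {P : Params} {𝔸 : Type*} [AddCommGroup 𝔸] [Module ℂ 𝔸]

/-- Averaging `f ∘ (first component of a product decomposition)` over the product is averaging `f` over the first factor.
[folklore] -/
theorem mean_comp_fst {K M : Type*} [Fintype K] [Fintype M] [Nonempty M] (e : K ≃ Idx P × M) (f : Idx P → 𝔸) :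
    ((Fintype.card K : ℂ))⁻¹ • ∑ k : K, f (e k).1 = ((Fintype.card (Idx P) : ℂ))⁻¹ • ∑ i : Idx P, f i := by
  have hM : (Fintype.card M : ℂ) ≠ 0 := by exact_mod_cast Fintype.card_ne_zero
  rw [Fintype.card_congr e, Fintype.sum_equiv e (fun k => f (e k).1) (fun q => f q.1) (fun _ => rfl), Fintype.card_prod,
    Fintype.sum_prod_type]
  simp only [Finset.sum_const, Finset.card_univ]
  rw [← Finset.smul_sum, ← Nat.cast_smul_eq_nsmul ℂ, smul_smul, Nat.cast_mul, mul_inv, mul_assoc, inv_mul_cancel₀ hM,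
    mul_one]

/-- Averaging a REAL function of the offset `r` only over `(r, σ₀, σ₁, σ₂, σ₃)` is averaging over the `L^d` offsets. [folklore] -/
theorem mean_of_fst (g : (Fin P.d → Fin P.L) → ℝ) :
    ((Fintype.card ((Fin P.d → Fin P.L) × Equiv.Perm (Fin P.d) × Equiv.Perm (Fin P.d) × Equiv.Perm (Fin P.d) ×
        Equiv.Perm (Fin P.d)) : ℝ))⁻¹ *
      ∑ k : (Fin P.d → Fin P.L) × Equiv.Perm (Fin P.d) × Equiv.Perm (Fin P.d) × Equiv.Perm (Fin P.d) × Equiv.Perm (Fin P.d),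
        g k.1 =
    ((P.L : ℝ) ^ P.d)⁻¹ * ∑ r : Fin P.d → Fin P.L, g r := by
  have hM : (Fintype.card (Equiv.Perm (Fin P.d) × Equiv.Perm (Fin P.d) × Equiv.Perm (Fin P.d) × Equiv.Perm (Fin P.d)) : ℝ) ≠ 0 := by
    exact_mod_cast Fintype.card_ne_zero
  rw [Fintype.card_prod, Fintype.sum_prod_type]
  simp only [Finset.sum_const, Finset.card_univ, nsmul_eq_mul]
  rw [← Finset.mul_sum, Nat.cast_mul, Fintype.card_fun, Fintype.card_fin, Fintype.card_fin, Nat.cast_pow, mul_inv, mul_assoc,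
    inv_mul_cancel_left₀ hM]

end Index

/-! ## §2 The correction factors as `exp[mean log]` over the loop family -/

section Corr

variable {n : Type*} [Fintype n] [DecidableEq n] [Nonempty n] {P : Params} {j : ℕ}

/-- In the model, `dist1 g = ‖g − 1‖` (operator norm). [folklore] -/
private theorem dist1_su_eq (g : Matrix.specialUnitaryGroup n ℂ) : dist1 g = ‖(g : Matrix n n ℂ) - 1‖ := rfl

/-- A special unitary matrix has operator norm `≤ 1`. [folklore] -/
private theorem norm_coe_su_le_one (g : Matrix.specialUnitaryGroup n ℂ) : ‖(g : Matrix n n ℂ)‖ ≤ 1 :=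
  (UnitaryModel.norm_of_mem_unitaryGroup (Matrix.specialUnitaryGroup_le_unitaryGroup g.2)).le

/-- **ON SMALL FIELDS THE CORRECTION FACTOR IS `eml` OF THE LOOP FAMILY OVER `Idx P`**: if every loop variable at `c` is within `δ_N`
of `1`, then `corr ℰ U c = exp[|Idx|⁻¹ Σ_i log W_c(i)]` as a matrix (the fixed enumeration of `LoopAverage.avg` is immaterial,
helper 1 `eml_comp_equiv'`). [cite: Balaban1987RG1, (0.4) p.253] -/
theorem coe_corr_eq_eml {U : GaugeField P j (Matrix.specialUnitaryGroup n ℂ)} {c : PBond P (j + 1)}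
    (h : ∀ i, dist1 (loopHol U c i) < deltaSU n) :
    ((corr (expMeanLogSU (n := n)) U c : Matrix.specialUnitaryGroup n ℂ) : Matrix n n ℂ) =
      eml (fun i : Idx P => ((loopHol U c i : Matrix.specialUnitaryGroup n ℂ) : Matrix n n ℂ)) := by
  have hsmall : Small (expMeanLogSU (n := n)) U c := h
  have hc : corr (expMeanLogSU (n := n)) U c = ESU (loopHol U c ∘ ⇑(LoopAverage.enum (Idx P)).symm) := by
    unfold corr
    rw [if_pos hsmall]
    rfl
  rw [hc, coe_ESU_of_small (W := loopHol U c ∘ ⇑(LoopAverage.enum (Idx P)).symm) (fun m => h _)]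
  exact eml_comp_equiv' (fun i : Idx P => ((loopHol U c i : Matrix.specialUnitaryGroup n ℂ) : Matrix n n ℂ))
    (LoopAverage.enum (Idx P)).symm

/-- The same for the INVERSE correction factor: `(corr ℰ U c)⁻¹ = eml` of the inverse loop family ((0.5) `avg_inv`).
[cite: Balaban1987RG1, (0.5) p.253] -/
theorem coe_corr_inv_eq_eml {U : GaugeField P j (Matrix.specialUnitaryGroup n ℂ)} {c : PBond P (j + 1)}
    (h : ∀ i, dist1 (loopHol U c i) < deltaSU n) :
    (((corr (expMeanLogSU (n := n)) U c)⁻¹ : Matrix.specialUnitaryGroup n ℂ) : Matrix n n ℂ) =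
      eml (fun i : Idx P => (((loopHol U c i)⁻¹ : Matrix.specialUnitaryGroup n ℂ) : Matrix n n ℂ)) := by
  have hsmall : Small (expMeanLogSU (n := n)) U c := h
  have h' : ∀ i, dist1 ((loopHol U c i)⁻¹) < deltaSU n := fun i => by rw [GaugeGroup.dist1_inv]; exact h i
  have hc : (corr (expMeanLogSU (n := n)) U c)⁻¹ =
      ESU ((fun i : Idx P => (loopHol U c i)⁻¹) ∘ ⇑(LoopAverage.enum (Idx P)).symm) := by
    have h1 : corr (expMeanLogSU (n := n)) U c = (expMeanLogSU (n := n)).avg (loopHol U c) := by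
      unfold corr
      rw [if_pos hsmall]
    rw [h1, ← (expMeanLogSU (n := n)).avg_inv (loopHol U c) h]
    rfl
  rw [hc, coe_ESU_of_small (W := (fun i : Idx P => (loopHol U c i)⁻¹) ∘ ⇑(LoopAverage.enum (Idx P)).symm) (fun m => h' _)]
  exact eml_comp_equiv' (fun i : Idx P => (((loopHol U c i)⁻¹ : Matrix.specialUnitaryGroup n ℂ) : Matrix n n ℂ))
    (LoopAverage.enum (Idx P)).symm

/-- **THE CORRECTION FACTOR TO FIRST ORDER**: under `PlaqSmall a U` (`a ≥ 0`), `t = (((d+2)L)²/4)·a ≤ 1/10`, `t < δ_N`: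
`‖corr(c) − 1 − |Idx|⁻¹ Σ_i (W_c(i) − 1)‖ ≤ 7t²`. [cite: Balaban1987RG1, (0.4) p.253] -/
theorem norm_corr_sub_mean_le {a : ℝ} (ha : 0 ≤ a) {U : GaugeField P j (Matrix.specialUnitaryGroup n ℂ)} (hU : PlaqSmall a U)
    (ht : ((((P.d + 2) * P.L : ℕ) : ℝ) ^ 2 / 4) * a ≤ 1 / 10) (hδ : ((((P.d + 2) * P.L : ℕ) : ℝ) ^ 2 / 4) * a < deltaSU n)
    (c : PBond P (j + 1)) :
    ‖((corr (expMeanLogSU (n := n)) U c : Matrix.specialUnitaryGroup n ℂ) : Matrix n n ℂ) - 1 -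
        ((Fintype.card (Idx P) : ℂ))⁻¹ • ∑ i : Idx P, (((loopHol U c i : Matrix.specialUnitaryGroup n ℂ) : Matrix n n ℂ) - 1)‖ ≤
      7 * (((((P.d + 2) * P.L : ℕ) : ℝ) ^ 2 / 4) * a) ^ 2 := by
  have hl : ∀ i, dist1 (loopHol U c i) ≤ ((((P.d + 2) * P.L : ℕ) : ℝ) ^ 2 / 4) * a := fun i => dist1_loopHol_le ha hU c i
  rw [coe_corr_eq_eml (fun i => (hl i).trans_lt hδ)]
  exact norm_eml_sub_one_sub_mean_le (fun i => hl i) ht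

/-- The same for the inverse correction factor and the inverse loop family. [cite: Balaban1987RG1, (0.5) p.253] -/
theorem norm_corr_inv_sub_mean_le {a : ℝ} (ha : 0 ≤ a) {U : GaugeField P j (Matrix.specialUnitaryGroup n ℂ)}
    (hU : PlaqSmall a U) (ht : ((((P.d + 2) * P.L : ℕ) : ℝ) ^ 2 / 4) * a ≤ 1 / 10)
    (hδ : ((((P.d + 2) * P.L : ℕ) : ℝ) ^ 2 / 4) * a < deltaSU n) (c : PBond P (j + 1)) :
    ‖(((corr (expMeanLogSU (n := n)) U c)⁻¹ : Matrix.specialUnitaryGroup n ℂ) : Matrix n n ℂ) - 1 -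
        ((Fintype.card (Idx P) : ℂ))⁻¹ •
          ∑ i : Idx P, ((((loopHol U c i)⁻¹ : Matrix.specialUnitaryGroup n ℂ) : Matrix n n ℂ) - 1)‖ ≤
      7 * (((((P.d + 2) * P.L : ℕ) : ℝ) ^ 2 / 4) * a) ^ 2 := by
  have hl : ∀ i, dist1 (loopHol U c i) ≤ ((((P.d + 2) * P.L : ℕ) : ℝ) ^ 2 / 4) * a := fun i => dist1_loopHol_le ha hU c i
  rw [coe_corr_inv_eq_eml (fun i => (hl i).trans_lt hδ)]
  refine norm_eml_sub_one_sub_mean_le (fun i => ?_) ht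
  rw [← dist1_su_eq, GaugeGroup.dist1_inv]
  exact hl i

end Corr

/-! ## §3 The coarse plaquette to first order -/

section Plaquette

variable {n : Type*} [Fintype n] [DecidableEq n] [Nonempty n] {P : Params} {j : ℕ}

/-- **THE COARSE PLAQUETTE OF THE (0.4)-AVERAGED FIELD TO FIRST ORDER** (standing range `j + 1 ≤ m + K`; `SU(N)`, printed
`exp[mean log]`): if `|U(∂q) − 1| < a` for all fine plaquettes (`a ≥ 0`) and `t := (((d+2)L)²/4)·a ≤ 1/10`, `t < δ_N`, then for every
coarse plaquette `p′ = (y; μ < ν)`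
`|Ū(∂p′) − 1| ≤ L^{−d} Σ_r Σ_{t′<L} Σ_{s<L} |U(∂q_{r,s,t′}) − 1| + 435·t²`,
`q_{r,s,t′} = (blockSite y r + s e_μ + t′ e_ν; μ, ν)`: to first order the coarse plaquette is the mean over `x ∈ B(y)` of the transported
`L × L` square holonomies at `x` (helper 2), the four correction factors being `1 +` mean deviations `+ O(t²)` (§2) and the product of
the four corrected transporters being affine in each correction up to `O(t²)` (helper 1). [cite: Balaban1987RG1, (0.4) p.253] -/
theorem dist1_plaqHol_avgFun_le_mean_add (hj : j + 1 ≤ P.m + P.K) {a : ℝ} (ha : 0 ≤ a)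
    {U : GaugeField P j (Matrix.specialUnitaryGroup n ℂ)} (hU : PlaqSmall a U)
    (ht : ((((P.d + 2) * P.L : ℕ) : ℝ) ^ 2 / 4) * a ≤ 1 / 10) (hδ : ((((P.d + 2) * P.L : ℕ) : ℝ) ^ 2 / 4) * a < deltaSU n)
    (p : Plaq P (j + 1)) :
    dist1 (GaugeField.plaqHol (avgFun (expMeanLogSU (n := n)) U) p) ≤
      ((P.L : ℝ) ^ P.d)⁻¹ * ∑ r : Fin P.d → Fin P.L, ∑ t ∈ Finset.range P.L, ∑ s ∈ Finset.range P.L,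
          dist1 (GaugeField.plaqHol U ⟨shiftN (shiftN (Site.blockSite p.src r) p.ν t) p.μ s, p.μ, p.ν, p.hμν⟩) +
        435 * (((((P.d + 2) * P.L : ℕ) : ℝ) ^ 2 / 4) * a) ^ 2 := by
  -- notation
  set τ : ℝ := ((((P.d + 2) * P.L : ℕ) : ℝ) ^ 2 / 4) * a with hτ
  have hτ0 : 0 ≤ τ := by positivity
  let K : Type := (Fin P.d → Fin P.L) × Equiv.Perm (Fin P.d) × Equiv.Perm (Fin P.d) × Equiv.Perm (Fin P.d) × Equiv.Perm (Fin P.d)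
  haveI : Nonempty K := ⟨(fun _ => ⟨0, P.L_pos⟩, 1, 1, 1, 1)⟩
  -- the coupled index decomposed along the four matched projections `(r,σ₀,σ₁)`, `(r,σ₁,σ₂)`, `(r,σ₃,σ₂)`, `(r,σ₀,σ₃)`
  let e₁ : K ≃ Idx P × (Equiv.Perm (Fin P.d) × Equiv.Perm (Fin P.d)) :=
    ⟨fun k => ((k.1, k.2.1, k.2.2.1), (k.2.2.2.1, k.2.2.2.2)), fun q => (q.1.1, q.1.2.1, q.1.2.2, q.2.1, q.2.2),
      fun _ => rfl, fun _ => rfl⟩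
  let e₂ : K ≃ Idx P × (Equiv.Perm (Fin P.d) × Equiv.Perm (Fin P.d)) :=
    ⟨fun k => ((k.1, k.2.2.1, k.2.2.2.1), (k.2.1, k.2.2.2.2)), fun q => (q.1.1, q.2.1, q.1.2.1, q.1.2.2, q.2.2),
      fun _ => rfl, fun _ => rfl⟩
  let e₃ : K ≃ Idx P × (Equiv.Perm (Fin P.d) × Equiv.Perm (Fin P.d)) :=
    ⟨fun k => ((k.1, k.2.2.2.2, k.2.2.2.1), (k.2.1, k.2.2.1)), fun q => (q.1.1, q.2.1, q.2.2, q.1.2.2, q.1.2.1),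
      fun _ => rfl, fun _ => rfl⟩
  let e₄ : K ≃ Idx P × (Equiv.Perm (Fin P.d) × Equiv.Perm (Fin P.d)) :=
    ⟨fun k => ((k.1, k.2.1, k.2.2.2.2), (k.2.2.1, k.2.2.2.1)), fun q => (q.1.1, q.1.2.1, q.2.1, q.2.2, q.1.2.2),
      fun _ => rfl, fun _ => rfl⟩
  -- the four bonds, correction factors, straight transporters
  set c₁ : PBond P (j + 1) := ⟨p.src, p.μ⟩ with hc₁
  set c₂ : PBond P (j + 1) := ⟨p.src.shift p.μ, p.ν⟩ with hc₂
  set c₃ : PBond P (j + 1) := ⟨p.src.shift p.ν, p.μ⟩ with hc₃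
  set c₄ : PBond P (j + 1) := ⟨p.src, p.ν⟩ with hc₄
  set E₁ : Matrix.specialUnitaryGroup n ℂ := corr (expMeanLogSU (n := n)) U c₁ with hE₁
  set E₂ : Matrix.specialUnitaryGroup n ℂ := corr (expMeanLogSU (n := n)) U c₂ with hE₂
  set E₃ : Matrix.specialUnitaryGroup n ℂ := corr (expMeanLogSU (n := n)) U c₃ with hE₃
  set E₄ : Matrix.specialUnitaryGroup n ℂ := corr (expMeanLogSU (n := n)) U c₄ with hE₄
  set A₁ : Matrix.specialUnitaryGroup n ℂ := axialAvg U c₁ with hA₁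
  set A₂ : Matrix.specialUnitaryGroup n ℂ := axialAvg U c₂ with hA₂
  set A₃ : Matrix.specialUnitaryGroup n ℂ := axialAvg U c₃ with hA₃
  set A₄ : Matrix.specialUnitaryGroup n ℂ := axialAvg U c₄ with hA₄
  -- smallness facts
  have hloop : ∀ (c : PBond P (j + 1)) (i : Idx P), dist1 (loopHol U c i) ≤ τ := fun c i => dist1_loopHol_le ha hU c i
  have hcorr : ∀ c : PBond P (j + 1), dist1 (corr (expMeanLogSU (n := n)) U c) ≤ 6 * τ := fun c => dist1_corr_le ha hU hδ c
  have h6τ : 6 * τ ≤ 1 := by linarith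
  have hτ1 : τ ≤ 1 := by linarith
  -- the four correction factors to first order, means transported to the coupled index
  have hρ₁ : ‖(E₁ : Matrix n n ℂ) - 1 - ((Fintype.card K : ℂ))⁻¹ •
      ∑ k : K, (((loopHol U c₁ (k.1, k.2.1, k.2.2.1) : Matrix.specialUnitaryGroup n ℂ) : Matrix n n ℂ) - 1)‖ ≤ 7 * τ ^ 2 := by
    have h : ((Fintype.card K : ℂ))⁻¹ •
        ∑ k : K, (((loopHol U c₁ (k.1, k.2.1, k.2.2.1) : Matrix.specialUnitaryGroup n ℂ) : Matrix n n ℂ) - 1) =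
        ((Fintype.card (Idx P) : ℂ))⁻¹ • ∑ i : Idx P, (((loopHol U c₁ i : Matrix.specialUnitaryGroup n ℂ) : Matrix n n ℂ) - 1) :=
      mean_comp_fst e₁ (fun i => ((loopHol U c₁ i : Matrix.specialUnitaryGroup n ℂ) : Matrix n n ℂ) - 1)
    rw [h]
    exact norm_corr_sub_mean_le ha hU ht hδ c₁
  have hρ₂ : ‖(E₂ : Matrix n n ℂ) - 1 - ((Fintype.card K : ℂ))⁻¹ •
      ∑ k : K, (((loopHol U c₂ (k.1, k.2.2.1, k.2.2.2.1) : Matrix.specialUnitaryGroup n ℂ) : Matrix n n ℂ) - 1)‖ ≤ 7 * τ ^ 2 := by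
    have h : ((Fintype.card K : ℂ))⁻¹ •
        ∑ k : K, (((loopHol U c₂ (k.1, k.2.2.1, k.2.2.2.1) : Matrix.specialUnitaryGroup n ℂ) : Matrix n n ℂ) - 1) =
        ((Fintype.card (Idx P) : ℂ))⁻¹ • ∑ i : Idx P, (((loopHol U c₂ i : Matrix.specialUnitaryGroup n ℂ) : Matrix n n ℂ) - 1) :=
      mean_comp_fst e₂ (fun i => ((loopHol U c₂ i : Matrix.specialUnitaryGroup n ℂ) : Matrix n n ℂ) - 1)
    rw [h]
    exact norm_corr_sub_mean_le ha hU ht hδ c₂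
  have hρ₃ : ‖((E₃⁻¹ : Matrix.specialUnitaryGroup n ℂ) : Matrix n n ℂ) - 1 - ((Fintype.card K : ℂ))⁻¹ •
      ∑ k : K, ((((loopHol U c₃ (k.1, k.2.2.2.2, k.2.2.2.1))⁻¹ : Matrix.specialUnitaryGroup n ℂ) : Matrix n n ℂ) - 1)‖ ≤
      7 * τ ^ 2 := by
    have h : ((Fintype.card K : ℂ))⁻¹ •
        ∑ k : K, ((((loopHol U c₃ (k.1, k.2.2.2.2, k.2.2.2.1))⁻¹ : Matrix.specialUnitaryGroup n ℂ) : Matrix n n ℂ) - 1) =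
        ((Fintype.card (Idx P) : ℂ))⁻¹ •
          ∑ i : Idx P, ((((loopHol U c₃ i)⁻¹ : Matrix.specialUnitaryGroup n ℂ) : Matrix n n ℂ) - 1) :=
      mean_comp_fst e₃ (fun i => (((loopHol U c₃ i)⁻¹ : Matrix.specialUnitaryGroup n ℂ) : Matrix n n ℂ) - 1)
    rw [h]
    exact norm_corr_inv_sub_mean_le ha hU ht hδ c₃
  have hρ₄ : ‖((E₄⁻¹ : Matrix.specialUnitaryGroup n ℂ) : Matrix n n ℂ) - 1 - ((Fintype.card K : ℂ))⁻¹ •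
      ∑ k : K, ((((loopHol U c₄ (k.1, k.2.1, k.2.2.2.2))⁻¹ : Matrix.specialUnitaryGroup n ℂ) : Matrix n n ℂ) - 1)‖ ≤
      7 * τ ^ 2 := by
    have h : ((Fintype.card K : ℂ))⁻¹ •
        ∑ k : K, ((((loopHol U c₄ (k.1, k.2.1, k.2.2.2.2))⁻¹ : Matrix.specialUnitaryGroup n ℂ) : Matrix n n ℂ) - 1) =
        ((Fintype.card (Idx P) : ℂ))⁻¹ •
          ∑ i : Idx P, ((((loopHol U c₄ i)⁻¹ : Matrix.specialUnitaryGroup n ℂ) : Matrix n n ℂ) - 1) :=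
      mean_comp_fst e₄ (fun i => (((loopHol U c₄ i)⁻¹ : Matrix.specialUnitaryGroup n ℂ) : Matrix n n ℂ) - 1)
    rw [h]
    exact norm_corr_inv_sub_mean_le ha hU ht hδ c₄
  -- helper 1 at these matrices
  have main := norm_prod4_sub_mean_le (𝔸 := Matrix n n ℂ) (κ := K)
    (g₁ := (A₁ : Matrix n n ℂ)) (g₂ := ((A₂ * A₃⁻¹ : Matrix.specialUnitaryGroup n ℂ) : Matrix n n ℂ))
    (g₃ := ((A₄⁻¹ : Matrix.specialUnitaryGroup n ℂ) : Matrix n n ℂ))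
    (X₁ := (E₁ : Matrix n n ℂ) - 1) (X₂ := (E₂ : Matrix n n ℂ) - 1)
    (X₃ := ((E₃⁻¹ : Matrix.specialUnitaryGroup n ℂ) : Matrix n n ℂ) - 1)
    (X₄ := ((E₄⁻¹ : Matrix.specialUnitaryGroup n ℂ) : Matrix n n ℂ) - 1)
    (Y₁ := fun k : K => ((loopHol U c₁ (k.1, k.2.1, k.2.2.1) : Matrix.specialUnitaryGroup n ℂ) : Matrix n n ℂ) - 1)
    (Y₂ := fun k : K => ((loopHol U c₂ (k.1, k.2.2.1, k.2.2.2.1) : Matrix.specialUnitaryGroup n ℂ) : Matrix n n ℂ) - 1)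
    (Y₃ := fun k : K => (((loopHol U c₃ (k.1, k.2.2.2.2, k.2.2.2.1))⁻¹ : Matrix.specialUnitaryGroup n ℂ) : Matrix n n ℂ) - 1)
    (Y₄ := fun k : K => (((loopHol U c₄ (k.1, k.2.1, k.2.2.2.2))⁻¹ : Matrix.specialUnitaryGroup n ℂ) : Matrix n n ℂ) - 1)
    (s := 6 * τ) (t := τ) (ρ := 7 * τ ^ 2)
    (norm_coe_su_le_one _) (norm_coe_su_le_one _) (norm_coe_su_le_one _)
    (by rw [← dist1_su_eq]; exact hcorr c₁) (by rw [← dist1_su_eq]; exact hcorr c₂)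
    (by rw [← dist1_su_eq, GaugeGroup.dist1_inv]; exact hcorr c₃)
    (by rw [← dist1_su_eq, GaugeGroup.dist1_inv]; exact hcorr c₄) h6τ
    (fun k => by rw [← dist1_su_eq]; exact hloop c₁ _) (fun k => by rw [← dist1_su_eq]; exact hloop c₂ _)
    (fun k => by rw [← dist1_su_eq, GaugeGroup.dist1_inv]; exact hloop c₃ _)
    (fun k => by rw [← dist1_su_eq, GaugeGroup.dist1_inv]; exact hloop c₄ _) hτ1 hρ₁ hρ₂ hρ₃ hρ₄
  -- identify the two products with the coarse plaquette and the concatenated loops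
  have hprod : (1 + ((E₁ : Matrix n n ℂ) - 1)) * (A₁ : Matrix n n ℂ) * (1 + ((E₂ : Matrix n n ℂ) - 1)) *
      ((A₂ * A₃⁻¹ : Matrix.specialUnitaryGroup n ℂ) : Matrix n n ℂ) *
      (1 + (((E₃⁻¹ : Matrix.specialUnitaryGroup n ℂ) : Matrix n n ℂ) - 1)) * ((A₄⁻¹ : Matrix.specialUnitaryGroup n ℂ) : Matrix n n ℂ) *
      (1 + (((E₄⁻¹ : Matrix.specialUnitaryGroup n ℂ) : Matrix n n ℂ) - 1)) =
      ((GaugeField.plaqHol (avgFun (expMeanLogSU (n := n)) U) p : Matrix.specialUnitaryGroup n ℂ) : Matrix n n ℂ) := by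
    simp only [add_sub_cancel]
    have : GaugeField.plaqHol (avgFun (expMeanLogSU (n := n)) U) p = E₁ * A₁ * E₂ * (A₂ * A₃⁻¹) * E₃⁻¹ * A₄⁻¹ * E₄⁻¹ := by
      show E₁ * A₁ * (E₂ * A₂) * (E₃ * A₃)⁻¹ * (E₄ * A₄)⁻¹ = _
      group
    rw [this]
    simp only [Submonoid.coe_mul]
  have hloops : ∀ k : K,
      (1 + (((loopHol U c₁ (k.1, k.2.1, k.2.2.1) : Matrix.specialUnitaryGroup n ℂ) : Matrix n n ℂ) - 1)) * (A₁ : Matrix n n ℂ) *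
      (1 + (((loopHol U c₂ (k.1, k.2.2.1, k.2.2.2.1) : Matrix.specialUnitaryGroup n ℂ) : Matrix n n ℂ) - 1)) *
      ((A₂ * A₃⁻¹ : Matrix.specialUnitaryGroup n ℂ) : Matrix n n ℂ) *
      (1 + ((((loopHol U c₃ (k.1, k.2.2.2.2, k.2.2.2.1))⁻¹ : Matrix.specialUnitaryGroup n ℂ) : Matrix n n ℂ) - 1)) *
      ((A₄⁻¹ : Matrix.specialUnitaryGroup n ℂ) : Matrix n n ℂ) *
      (1 + ((((loopHol U c₄ (k.1, k.2.1, k.2.2.2.2))⁻¹ : Matrix.specialUnitaryGroup n ℂ) : Matrix n n ℂ) - 1)) =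
      ((loopHol U c₁ (k.1, k.2.1, k.2.2.1) * A₁ * (loopHol U c₂ (k.1, k.2.2.1, k.2.2.2.1) * A₂) *
          (loopHol U c₃ (k.1, k.2.2.2.2, k.2.2.2.1) * A₃)⁻¹ * (loopHol U c₄ (k.1, k.2.1, k.2.2.2.2) * A₄)⁻¹ :
          Matrix.specialUnitaryGroup n ℂ) : Matrix n n ℂ) := by
    intro k
    simp only [add_sub_cancel]
    have : loopHol U c₁ (k.1, k.2.1, k.2.2.1) * A₁ * (loopHol U c₂ (k.1, k.2.2.1, k.2.2.2.1) * A₂) *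
        (loopHol U c₃ (k.1, k.2.2.2.2, k.2.2.2.1) * A₃)⁻¹ * (loopHol U c₄ (k.1, k.2.1, k.2.2.2.2) * A₄)⁻¹ =
        loopHol U c₁ (k.1, k.2.1, k.2.2.1) * A₁ * loopHol U c₂ (k.1, k.2.2.1, k.2.2.2.1) * (A₂ * A₃⁻¹) *
          (loopHol U c₃ (k.1, k.2.2.2.2, k.2.2.2.1))⁻¹ * A₄⁻¹ * (loopHol U c₄ (k.1, k.2.1, k.2.2.2.2))⁻¹ := by group
    rw [this]
    simp only [Submonoid.coe_mul]
  rw [hprod, Finset.sum_congr rfl fun k _ => hloops k] at main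
  -- the distance of each concatenated loop to `1` (helper 2)
  have hP : ∀ k : K, ‖((loopHol U c₁ (k.1, k.2.1, k.2.2.1) * A₁ * (loopHol U c₂ (k.1, k.2.2.1, k.2.2.2.1) * A₂) *
          (loopHol U c₃ (k.1, k.2.2.2.2, k.2.2.2.1) * A₃)⁻¹ * (loopHol U c₄ (k.1, k.2.1, k.2.2.2.2) * A₄)⁻¹ :
          Matrix.specialUnitaryGroup n ℂ) : Matrix n n ℂ) - 1‖ ≤
      ∑ t ∈ Finset.range P.L, ∑ s ∈ Finset.range P.L,
        dist1 (GaugeField.plaqHol U ⟨shiftN (shiftN (Site.blockSite p.src k.1) p.ν t) p.μ s, p.μ, p.ν, p.hμν⟩) := by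
    intro k
    rw [← dist1_su_eq]
    exact dist1_fourLoops_le hj U p k.1 k.2.1 k.2.2.1 k.2.2.2.1 k.2.2.2.2
  -- the mean of a constant
  have hcK : (0 : ℝ) < Fintype.card K := Nat.cast_pos.mpr Fintype.card_pos
  have hcKC : (Fintype.card K : ℂ) ≠ 0 := by exact_mod_cast hcK.ne'
  have hmean1 : ((Fintype.card K : ℂ))⁻¹ • ∑ _k : K, (1 : Matrix n n ℂ) = 1 := by
    rw [Finset.sum_const, Finset.card_univ, ← Nat.cast_smul_eq_nsmul ℂ, smul_smul, inv_mul_cancel₀ hcKC, one_smul]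
  -- assemble: `Ū(∂p′) − 1 = [Ū(∂p′) − mean P_k] + mean (P_k − 1)`
  set M : Matrix n n ℂ := ((GaugeField.plaqHol (avgFun (expMeanLogSU (n := n)) U) p : Matrix.specialUnitaryGroup n ℂ) :
    Matrix n n ℂ) with hM
  set Pk : K → Matrix n n ℂ := fun k =>
    ((loopHol U c₁ (k.1, k.2.1, k.2.2.1) * A₁ * (loopHol U c₂ (k.1, k.2.2.1, k.2.2.2.1) * A₂) *
        (loopHol U c₃ (k.1, k.2.2.2.2, k.2.2.2.1) * A₃)⁻¹ * (loopHol U c₄ (k.1, k.2.1, k.2.2.2.2) * A₄)⁻¹ :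
        Matrix.specialUnitaryGroup n ℂ) : Matrix n n ℂ) with hPk
  have main' : ‖M - ((Fintype.card K : ℂ))⁻¹ • ∑ k : K, Pk k‖ ≤ 4 * (7 * τ ^ 2) + 11 * (6 * τ) ^ 2 + 11 * τ ^ 2 := main
  have hsplit : M - 1 = (M - ((Fintype.card K : ℂ))⁻¹ • ∑ k : K, Pk k) + ((Fintype.card K : ℂ))⁻¹ • ∑ k : K, (Pk k - 1) := by
    rw [Finset.sum_sub_distrib, smul_sub, hmean1]
    abel
  have hmeanP : ‖((Fintype.card K : ℂ))⁻¹ • ∑ k : K, (Pk k - 1)‖ ≤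
      ((P.L : ℝ) ^ P.d)⁻¹ * ∑ r : Fin P.d → Fin P.L, ∑ t ∈ Finset.range P.L, ∑ s ∈ Finset.range P.L,
          dist1 (GaugeField.plaqHol U ⟨shiftN (shiftN (Site.blockSite p.src r) p.ν t) p.μ s, p.μ, p.ν, p.hμν⟩) := by
    rw [← mean_of_fst (fun r => ∑ t ∈ Finset.range P.L, ∑ s ∈ Finset.range P.L,
          dist1 (GaugeField.plaqHol U ⟨shiftN (shiftN (Site.blockSite p.src r) p.ν t) p.μ s, p.μ, p.ν, p.hμν⟩)),
      norm_smul, norm_inv, Complex.norm_natCast]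
    refine mul_le_mul_of_nonneg_left ((norm_sum_le _ _).trans (Finset.sum_le_sum fun k _ => ?_)) (inv_nonneg.mpr hcK.le)
    exact hP k
  rw [dist1_su_eq, ← hM, hsplit]
  refine (norm_add_le _ _).trans ?_
  have h435 : 4 * (7 * τ ^ 2) + 11 * (6 * τ) ^ 2 + 11 * τ ^ 2 = 435 * τ ^ 2 := by ring
  linarith [main', hmeanP, h435]

end Plaquette

end Summit.QuantumFields.YangMills.Theorems.AvgActionDefect

end
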